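import Summits.CriticalPhenomena.PercolationContinuityZ3.Theorems.Transplant.FKConnectivityAllQAntipodalRootFormRealDefs
import Summits.CriticalPhenomena.PercolationContinuityZ3.Theorems.Transplant.FKConnectivityAllQAntipodalRootFormTransfer
import Summits.CriticalPhenomena.PercolationContinuityZ3.Theorems.Transplant.FKConnectivityAllQAntipodalMajMixNested
import Summits.CriticalPhenomena.PercolationContinuityZ3.Theorems.Transplant.FKConnectivityAllQWheelAutomaton
import HarnessLib

/-!
# Connectivity correlation inequalities for `φ_{w,q}`, every `q > 0` — ROOT-FORM CALCULUS, file 61r: the two LETTERS on real environments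
# (a fresh series / parallel free edge turns the real environment into `serE` / `parE` of itself, up to reindexing and a level shift)

Support file (`--supports stmt-CriticalPhenomena-4575`), FK sub-lane `prim-bschramm-fk-2` (gen 29); builds on p205010 (kernel theorem,
internal audit signed; external expert review pending).  No definitions, no named facts, no sorries; standard axioms.  Memo
FROM-fk-2-g28-ROOT-FORM.md §7 (L4d); FK-Q2 §38.

* `realPDat_ser_true/false` — attaching a free edge `f = a m` IN SERIES at the pole `m` of an environment with poles `m, b` (`a` a fresh
  vertex, the new poles being `a, b`): the pattern data of the new environment at `X ∪ {f}` resp. `X` are `PDat.ser true/false` of the old data,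
  every level lowered by `1` (the vertex `a` is no longer isolated in one replica);
* `realPDat_par_true/false` — attaching `g = a b` IN PARALLEL (a new edge between the poles): `PDat.par`, levels lowered by `1`;
* `realEnv_ser_facts`, `realEnv_par_facts` — hence the five facts of the word theorem pass from the real environment of `𝓔` to those of
  `f·𝓔` and `g ∥ 𝓔` (abstract steps of files 61a/61b + the transfer of file 61q along `Bool × ↥M.powerset ≃ ↥(insert f M).powerset`).
[cite: Grimmett2006, §1.4 eq. (1.20) (p. 15); §3.8 (pp. 61–62)]
-/

noncomputable section

namespace Summit.CriticalPhenomena.PercolationContinuityZ3.Theorems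

namespace FK

namespace RootForm

open SimpleGraph Finset Literature.Probability.LatticeModels Literature.Probability.Percolation
open scoped Classical

variable {V : Type*} [Fintype V]

section Letters

variable {M C : Finset (Sym2 V)} {a m b : V} {y z : Sym2 V}

/-- **Series letter, edge in replica 1.**  `f = a m` with `a` off every edge of `M ∪ C ∪ {y,z}` and `a ≠ b`; for `X ⊆ M ∪ {y,z}`:
the datum of the new environment (poles `a, b`, free set `M ∪ f`) at `X ∪ f` is `⟨Λ − 1, K¹, 0⟩`. [cite: Grimmett2006, §1.4 eq. (1.20) (p. 15)] -/
theorem realPDat_ser_true (ha : ∀ e ∈ insert y (insert z (M ∪ C)), a ∉ e) (hab : a ≠ b) (ham : a ≠ m)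
    {X : Finset (Sym2 V)} (hX : X ⊆ insert y (insert z M)) :
    realPDat (insert s(a, m) M) C a b y z (insert s(a, m) X) =
      ⟨(realPDat M C m b y z X).lam + (-1), (realPDat M C m b y z X).k1, false⟩ := by
  have hsub : ∀ Y : Finset (Sym2 V), Y ⊆ insert y (insert z (M ∪ C)) → ∀ e ∈ Y, a ∉ e := fun Y hY e he => ha e (hY he)
  have hXC : X ∪ C ⊆ insert y (insert z (M ∪ C)) := Finset.union_subset
    (hX.trans (Finset.insert_subset_insert _ (Finset.insert_subset_insert _ Finset.subset_union_left)))
    ((Finset.subset_union_right).trans ((Finset.subset_insert _ _).trans (Finset.subset_insert _ _)))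
  have hMC : insert y (insert z M) \ X ∪ C ⊆ insert y (insert z (M ∪ C)) := Finset.union_subset
    (Finset.sdiff_subset.trans (Finset.insert_subset_insert _ (Finset.insert_subset_insert _ Finset.subset_union_left)))
    ((Finset.subset_union_right).trans ((Finset.subset_insert _ _).trans (Finset.subset_insert _ _)))
  have hfM : s(a, m) ∉ insert y (insert z M) := fun h =>
    ha _ ((Finset.insert_subset_insert _ (Finset.insert_subset_insert _ Finset.subset_union_left)) h) (Sym2.mem_mk_left _ _)
  have n1 : ¬ (openGraph (↑(X ∪ C) : BondConfig V)).Reachable a m := fun h =>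
    Wheel.not_reachable_of_fresh (hsub _ hXC) ham.symm h.symm
  have n2 : ¬ (openGraph (↑(X ∪ C) : BondConfig V)).Reachable a b := fun h =>
    Wheel.not_reachable_of_fresh (hsub _ hXC) hab.symm h.symm
  have n3 : ¬ (openGraph (↑(insert y (insert z M) \ X ∪ C) : BondConfig V)).Reachable a b := fun h =>
    Wheel.not_reachable_of_fresh (hsub _ hMC) hab.symm h.symm
  have k1 := clusterCount_insert_add_ite (X ∪ C) a m
  rw [if_neg n1] at k1
  have e1 : insert s(a, m) X ∪ C = insert s(a, m) (X ∪ C) := Finset.insert_union _ _ _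
  have e2 : insert y (insert z (insert s(a, m) M)) \ insert s(a, m) X ∪ C = insert y (insert z M) \ X ∪ C := by
    rw [Finset.insert_comm z s(a, m) M, Finset.insert_comm y s(a, m), Finset.insert_sdiff_insert, Finset.sdiff_insert_of_notMem hfM]
  have r1 : (openGraph (↑(insert s(a, m) (X ∪ C)) : BondConfig V)).Reachable a b ↔ (openGraph (↑(X ∪ C) : BondConfig V)).Reachable m b := by
    rw [Wheel.reachable_coe_insert_iff]
    constructor
    · rintro (h | ⟨_, h⟩ | ⟨h, _⟩)
      · exact absurd h n2
      · exact h
      · exact absurd h n1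
    · exact fun h => Or.inr (Or.inl ⟨Reachable.refl _, h⟩)
  simp only [realPDat, apExpC, e1, e2, reachB, n3, decide_false, PDat.mk.injEq, and_true]
  refine ⟨by omega, ?_⟩
  rw [Bool.eq_iff_iff]; simp only [decide_eq_true_eq]; exact r1

/-- **Series letter, edge in replica 2.**  The datum at `X` (`f` in the second replica) is `⟨Λ − 1, 0, K²⟩`. [cite: Grimmett2006, §1.4 eq. (1.20) (p. 15)] -/
theorem realPDat_ser_false (ha : ∀ e ∈ insert y (insert z (M ∪ C)), a ∉ e) (hab : a ≠ b) (ham : a ≠ m)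
    {X : Finset (Sym2 V)} (hX : X ⊆ insert y (insert z M)) :
    realPDat (insert s(a, m) M) C a b y z X = ⟨(realPDat M C m b y z X).lam + (-1), false, (realPDat M C m b y z X).k2⟩ := by
  have hsub : ∀ Y : Finset (Sym2 V), Y ⊆ insert y (insert z (M ∪ C)) → ∀ e ∈ Y, a ∉ e := fun Y hY e he => ha e (hY he)
  have hXC : X ∪ C ⊆ insert y (insert z (M ∪ C)) := Finset.union_subset
    (hX.trans (Finset.insert_subset_insert _ (Finset.insert_subset_insert _ Finset.subset_union_left)))
    ((Finset.subset_union_right).trans ((Finset.subset_insert _ _).trans (Finset.subset_insert _ _)))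
  have hMC : insert y (insert z M) \ X ∪ C ⊆ insert y (insert z (M ∪ C)) := Finset.union_subset
    (Finset.sdiff_subset.trans (Finset.insert_subset_insert _ (Finset.insert_subset_insert _ Finset.subset_union_left)))
    ((Finset.subset_union_right).trans ((Finset.subset_insert _ _).trans (Finset.subset_insert _ _)))
  have hfX : s(a, m) ∉ X := fun h =>
    ha _ ((hX.trans (Finset.insert_subset_insert _ (Finset.insert_subset_insert _ Finset.subset_union_left))) h) (Sym2.mem_mk_left _ _)
  have n1 : ¬ (openGraph (↑(insert y (insert z M) \ X ∪ C) : BondConfig V)).Reachable a m := fun h =>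
    Wheel.not_reachable_of_fresh (hsub _ hMC) ham.symm h.symm
  have n2 : ¬ (openGraph (↑(insert y (insert z M) \ X ∪ C) : BondConfig V)).Reachable a b := fun h =>
    Wheel.not_reachable_of_fresh (hsub _ hMC) hab.symm h.symm
  have n3 : ¬ (openGraph (↑(X ∪ C) : BondConfig V)).Reachable a b := fun h =>
    Wheel.not_reachable_of_fresh (hsub _ hXC) hab.symm h.symm
  have k1 := clusterCount_insert_add_ite (insert y (insert z M) \ X ∪ C) a m
  rw [if_neg n1] at k1
  have e2 : insert y (insert z (insert s(a, m) M)) \ X ∪ C = insert s(a, m) (insert y (insert z M) \ X ∪ C) := by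
    rw [Finset.insert_comm z s(a, m) M, Finset.insert_comm y s(a, m), Finset.insert_sdiff_of_notMem _ hfX, Finset.insert_union]
  have r1 : (openGraph (↑(insert s(a, m) (insert y (insert z M) \ X ∪ C)) : BondConfig V)).Reachable a b ↔
      (openGraph (↑(insert y (insert z M) \ X ∪ C) : BondConfig V)).Reachable m b := by
    rw [Wheel.reachable_coe_insert_iff]
    constructor
    · rintro (h | ⟨_, h⟩ | ⟨h, _⟩)
      · exact absurd h n2
      · exact h
      · exact absurd h n1
    · exact fun h => Or.inr (Or.inl ⟨Reachable.refl _, h⟩)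
  simp only [realPDat, apExpC, e2, reachB, n3, decide_false, PDat.mk.injEq, true_and]
  refine ⟨by omega, ?_⟩
  rw [Bool.eq_iff_iff]; simp only [decide_eq_true_eq]; exact r1

/-- **Parallel letter, edge in replica 1.**  `g = a b ∉ M ∪ C ∪ {y,z}`, `a ≠ b`; for `X ⊆ M ∪ {y,z}` the datum of the new environment
(free set `M ∪ g`) at `X ∪ g` is `⟨Λ + K¹ − 1, 1, K²⟩`. [cite: Grimmett2006, §1.4 eq. (1.20) (p. 15)] -/
theorem realPDat_par_true (hg : s(a, b) ∉ insert y (insert z (M ∪ C))) (hab : a ≠ b) (X : Finset (Sym2 V)) :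
    realPDat (insert s(a, b) M) C a b y z (insert s(a, b) X) =
      ⟨(realPDat M C a b y z X).lam + bit (realPDat M C a b y z X).k1 + (-1), true, (realPDat M C a b y z X).k2⟩ := by
  have hgM : s(a, b) ∉ insert y (insert z M) := fun h =>
    hg ((Finset.insert_subset_insert _ (Finset.insert_subset_insert _ Finset.subset_union_left)) h)
  have hgC : s(a, b) ∉ C := fun h => hg (Finset.mem_insert_of_mem (Finset.mem_insert_of_mem (Finset.mem_union_right _ h)))
  have k1 := clusterCount_insert_add_ite (X ∪ C) a b
  have e1 : insert s(a, b) X ∪ C = insert s(a, b) (X ∪ C) := Finset.insert_union _ _ _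
  have e2 : insert y (insert z (insert s(a, b) M)) \ insert s(a, b) X ∪ C = insert y (insert z M) \ X ∪ C := by
    rw [Finset.insert_comm z s(a, b) M, Finset.insert_comm y s(a, b), Finset.insert_sdiff_insert, Finset.sdiff_insert_of_notMem hgM]
  have r1 : (openGraph (↑(insert s(a, b) (X ∪ C)) : BondConfig V)).Reachable a b :=
    Adj.reachable ((openGraph_adj _ _ _).2 ⟨by rw [Finset.coe_insert]; exact Set.mem_insert _ _, hab⟩)
  simp only [realPDat, apExpC, e1, e2, reachB, r1, decide_true, PDat.mk.injEq, bit]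
  by_cases hr : (openGraph (↑(X ∪ C) : BondConfig V)).Reachable a b <;>
    simp only [hr, if_true, if_false, decide_true, decide_false, Bool.false_eq_true] at k1 ⊢ <;>
    refine ⟨by omega, ?_, ?_⟩ <;> first | trivial | (rw [Bool.eq_iff_iff]; simp only [decide_eq_true_eq])

/-- **Parallel letter, edge in replica 2.**  The datum at `X` (`g` in the second replica) is `⟨Λ + K² − 1, K¹, 1⟩`.
[cite: Grimmett2006, §1.4 eq. (1.20) (p. 15)] -/
theorem realPDat_par_false (hg : s(a, b) ∉ insert y (insert z (M ∪ C))) (hab : a ≠ b) {X : Finset (Sym2 V)} (hX : X ⊆ insert y (insert z M)) :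
    realPDat (insert s(a, b) M) C a b y z X =
      ⟨(realPDat M C a b y z X).lam + bit (realPDat M C a b y z X).k2 + (-1), (realPDat M C a b y z X).k1, true⟩ := by
  have hgX : s(a, b) ∉ X := fun h =>
    hg ((hX.trans (Finset.insert_subset_insert _ (Finset.insert_subset_insert _ Finset.subset_union_left))) h)
  have k1 := clusterCount_insert_add_ite (insert y (insert z M) \ X ∪ C) a b
  have e2 : insert y (insert z (insert s(a, b) M)) \ X ∪ C = insert s(a, b) (insert y (insert z M) \ X ∪ C) := by
    rw [Finset.insert_comm z s(a, b) M, Finset.insert_comm y s(a, b), Finset.insert_sdiff_of_notMem _ hgX, Finset.insert_union]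
  have r1 : (openGraph (↑(insert s(a, b) (insert y (insert z M) \ X ∪ C)) : BondConfig V)).Reachable a b :=
    Adj.reachable ((openGraph_adj _ _ _).2 ⟨by rw [Finset.coe_insert]; exact Set.mem_insert _ _, hab⟩)
  simp only [realPDat, apExpC, e2, reachB, r1, decide_true, PDat.mk.injEq, bit]
  by_cases hr : (openGraph (↑(insert y (insert z M) \ X ∪ C) : BondConfig V)).Reachable a b <;>
    simp only [hr, if_true, if_false, decide_true, decide_false, Bool.false_eq_true] at k1 ⊢ <;>
    exact ⟨by omega, trivial, trivial⟩

/-! ### The five facts across a letter -/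

/-- **Series letter: the five facts pass from `𝓔` (poles `m, b`) to `f·𝓔` (poles `a, b`, `f = a m` fresh and free).** [folklore] -/
theorem realEnv_ser_facts (ha : ∀ e ∈ insert y (insert z (M ∪ C)), a ∉ e) (hab : a ≠ b) (ham : a ≠ m)
    (h5 : (∀ h0 h1 : ↥M.powerset → ℝ, Monotone h0 → Monotone h1 → (∀ γ, 0 ≤ h0 γ) → (∀ γ, h0 γ ≤ h1 γ) → ∀ J : ℤ,
        0 ≤ Mt (realEnv M C m b y z) h0 h1 J)
      ∧ (∀ h0 h1 : Bool × ↥M.powerset → ℝ, Monotone h0 → Monotone h1 → (∀ p, 0 ≤ h0 p) → (∀ p, h0 p ≤ h1 p) → ∀ J : ℤ,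
        0 ≤ Mt (parE (realEnv M C m b y z)) h0 h1 J)
      ∧ (∀ h : ↥M.powerset → ℝ, Monotone h → (∀ γ, 0 ≤ h γ) → ∀ J : ℤ, 0 ≤ ∑ γ, h γ * (realEnv M C m b y z γ).andDel J)
      ∧ (∀ h : ↥M.powerset → ℝ, Monotone h → (∀ γ, 0 ≤ h γ) → ∀ J : ℤ, 0 ≤ ∑ γ, h γ * (realEnv M C m b y z γ).andCon J)
      ∧ (∀ h0 h1 : ↥M.powerset → ℝ, Monotone h0 → Monotone h1 → (∀ γ, 0 ≤ h0 γ) → (∀ γ, h0 γ ≤ h1 γ) → ∀ J : ℤ,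
          0 ≤ ∑ γ, (h1 γ * (realEnv M C m b y z γ).andE1 J + h0 γ * (realEnv M C m b y z γ).andE2 J))) :
    (∀ h0 h1 : ↥(insert s(a, m) M).powerset → ℝ, Monotone h0 → Monotone h1 → (∀ γ, 0 ≤ h0 γ) → (∀ γ, h0 γ ≤ h1 γ) → ∀ J : ℤ,
        0 ≤ Mt (realEnv (insert s(a, m) M) C a b y z) h0 h1 J)
      ∧ (∀ h0 h1 : Bool × ↥(insert s(a, m) M).powerset → ℝ, Monotone h0 → Monotone h1 → (∀ p, 0 ≤ h0 p) → (∀ p, h0 p ≤ h1 p) →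
        ∀ J : ℤ, 0 ≤ Mt (parE (realEnv (insert s(a, m) M) C a b y z)) h0 h1 J)
      ∧ (∀ h : ↥(insert s(a, m) M).powerset → ℝ, Monotone h → (∀ γ, 0 ≤ h γ) → ∀ J : ℤ,
        0 ≤ ∑ γ, h γ * (realEnv (insert s(a, m) M) C a b y z γ).andDel J)
      ∧ (∀ h : ↥(insert s(a, m) M).powerset → ℝ, Monotone h → (∀ γ, 0 ≤ h γ) → ∀ J : ℤ,
        0 ≤ ∑ γ, h γ * (realEnv (insert s(a, m) M) C a b y z γ).andCon J)
      ∧ (∀ h0 h1 : ↥(insert s(a, m) M).powerset → ℝ, Monotone h0 → Monotone h1 → (∀ γ, 0 ≤ h0 γ) → (∀ γ, h0 γ ≤ h1 γ) → ∀ J : ℤ,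
          0 ≤ ∑ γ, (h1 γ * (realEnv (insert s(a, m) M) C a b y z γ).andE1 J + h0 γ * (realEnv (insert s(a, m) M) C a b y z γ).andE2 J)) := by
  have hfM : s(a, m) ∉ M := fun h =>
    ha _ (Finset.mem_insert_of_mem (Finset.mem_insert_of_mem (Finset.mem_union_left _ h))) (Sym2.mem_mk_left _ _)
  obtain ⟨f1, f2, f3, f4, f5⟩ := h5
  let φ : Bool × ↥M.powerset ≃ ↥(insert s(a, m) M).powerset :=
    { toFun := fun p => ⟨if p.1 then insert s(a, m) p.2.1 else p.2.1, Finset.mem_powerset.2 (by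
        split_ifs
        · exact Finset.insert_subset_insert _ (Finset.mem_powerset.1 p.2.2)
        · exact (Finset.mem_powerset.1 p.2.2).trans (Finset.subset_insert _ _))⟩
      invFun := fun δ => (decide (s(a, m) ∈ δ.1), ⟨δ.1.erase s(a, m), Finset.mem_powerset.2 fun e he =>
        (Finset.mem_insert.1 (Finset.mem_powerset.1 δ.2 (Finset.mem_of_mem_erase he))).resolve_left (Finset.ne_of_mem_erase he)⟩)
      left_inv := fun p => by
        obtain ⟨t, β⟩ := p
        have hfβ : s(a, m) ∉ β.1 := fun h => hfM (Finset.mem_powerset.1 β.2 h)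
        cases t
        · exact Prod.ext (by simp [hfβ]) (Subtype.ext (by simp [Finset.erase_eq_of_notMem hfβ]))
        · exact Prod.ext (by simp) (Subtype.ext (by simp [Finset.erase_insert hfβ]))
      right_inv := fun δ => by
        by_cases h : s(a, m) ∈ δ.1
        · exact Subtype.ext (by simp [h, Finset.insert_erase h])
        · exact Subtype.ext (by simp [h]) }
  have hφ : Monotone φ := by
    rintro ⟨t, β⟩ ⟨t', β'⟩ hle
    obtain ⟨hb, hβ⟩ := Prod.mk_le_mk.1 hle
    show (if t then insert s(a, m) β.1 else β.1) ⊆ (if t' then insert s(a, m) β'.1 else β'.1)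
    cases t <;> cases t' <;> simp only [Bool.false_eq_true, ↓reduceIte]
    · exact hβ
    · exact fun e he => Finset.mem_insert_of_mem (hβ he)
    · exact absurd hb (by decide)
    · exact Finset.insert_subset_insert _ hβ
  refine transfer_facts (E := serE (realEnv M C m b y z)) (κ := -1) hφ ?_
    ⟨fun _ _ m0 m1 n0 le J => Mt_ser_nonneg f1 f3 m0 m1 n0 le J, fun _ _ m0 m1 n0 le J => Mt_par_ser_nonneg f1 f3 f5 m0 m1 n0 le J,
      fun _ mh nh J => andDel_ser_nonneg f3 mh nh J, fun _ mh nh J => andCon_ser_nonneg f5 mh nh J,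
      fun _ _ m0 m1 n0 le J => andFree_ser_nonneg f5 f3 m0 m1 n0 le J⟩
  rintro ⟨bb, β⟩
  have hX : β.1 ⊆ M := Finset.mem_powerset.1 β.2
  have p0 : β.1 ⊆ insert y (insert z M) := hX.trans ((Finset.subset_insert _ _).trans (Finset.subset_insert _ _))
  have py : insert y β.1 ⊆ insert y (insert z M) := Finset.insert_subset_insert _ (hX.trans (Finset.subset_insert _ _))
  have pz : insert z β.1 ⊆ insert y (insert z M) := (Finset.insert_subset_insert _ hX).trans (Finset.subset_insert _ _)
  have pyz : insert y (insert z β.1) ⊆ insert y (insert z M) := Finset.insert_subset_insert _ (Finset.insert_subset_insert _ hX)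
  cases bb
  · show realEnv (insert s(a, m) M) C a b y z ⟨β.1, _⟩ = _
    simp only [realEnv, serE, EDat.ser, PDat.ser, realPDat_ser_false ha hab ham p0, realPDat_ser_false ha hab ham py,
      realPDat_ser_false ha hab ham pz, realPDat_ser_false ha hab ham pyz, Bool.false_and, Bool.not_false, Bool.true_and]
  · show realEnv (insert s(a, m) M) C a b y z ⟨insert s(a, m) β.1, _⟩ = _
    simp only [realEnv, serE, EDat.ser, PDat.ser, Finset.insert_comm y s(a, m), Finset.insert_comm z s(a, m),
      realPDat_ser_true ha hab ham p0, realPDat_ser_true ha hab ham py, realPDat_ser_true ha hab ham pz,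
      realPDat_ser_true ha hab ham pyz, Bool.true_and, Bool.not_true, Bool.false_and]


/-- **Parallel letter: the five facts pass from `𝓔` to `g ∥ 𝓔` (`g = a b` a new free edge between the poles).** [folklore] -/
theorem realEnv_par_facts (hg : s(a, b) ∉ insert y (insert z (M ∪ C))) (hab : a ≠ b)
    (h5 : (∀ h0 h1 : ↥M.powerset → ℝ, Monotone h0 → Monotone h1 → (∀ γ, 0 ≤ h0 γ) → (∀ γ, h0 γ ≤ h1 γ) → ∀ J : ℤ,
        0 ≤ Mt (realEnv M C a b y z) h0 h1 J)
      ∧ (∀ h0 h1 : Bool × ↥M.powerset → ℝ, Monotone h0 → Monotone h1 → (∀ p, 0 ≤ h0 p) → (∀ p, h0 p ≤ h1 p) → ∀ J : ℤ,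
        0 ≤ Mt (parE (realEnv M C a b y z)) h0 h1 J)
      ∧ (∀ h : ↥M.powerset → ℝ, Monotone h → (∀ γ, 0 ≤ h γ) → ∀ J : ℤ, 0 ≤ ∑ γ, h γ * (realEnv M C a b y z γ).andDel J)
      ∧ (∀ h : ↥M.powerset → ℝ, Monotone h → (∀ γ, 0 ≤ h γ) → ∀ J : ℤ, 0 ≤ ∑ γ, h γ * (realEnv M C a b y z γ).andCon J)
      ∧ (∀ h0 h1 : ↥M.powerset → ℝ, Monotone h0 → Monotone h1 → (∀ γ, 0 ≤ h0 γ) → (∀ γ, h0 γ ≤ h1 γ) → ∀ J : ℤ,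
          0 ≤ ∑ γ, (h1 γ * (realEnv M C a b y z γ).andE1 J + h0 γ * (realEnv M C a b y z γ).andE2 J))) :
    (∀ h0 h1 : ↥(insert s(a, b) M).powerset → ℝ, Monotone h0 → Monotone h1 → (∀ γ, 0 ≤ h0 γ) → (∀ γ, h0 γ ≤ h1 γ) → ∀ J : ℤ,
        0 ≤ Mt (realEnv (insert s(a, b) M) C a b y z) h0 h1 J)
      ∧ (∀ h0 h1 : Bool × ↥(insert s(a, b) M).powerset → ℝ, Monotone h0 → Monotone h1 → (∀ p, 0 ≤ h0 p) → (∀ p, h0 p ≤ h1 p) →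
        ∀ J : ℤ, 0 ≤ Mt (parE (realEnv (insert s(a, b) M) C a b y z)) h0 h1 J)
      ∧ (∀ h : ↥(insert s(a, b) M).powerset → ℝ, Monotone h → (∀ γ, 0 ≤ h γ) → ∀ J : ℤ,
        0 ≤ ∑ γ, h γ * (realEnv (insert s(a, b) M) C a b y z γ).andDel J)
      ∧ (∀ h : ↥(insert s(a, b) M).powerset → ℝ, Monotone h → (∀ γ, 0 ≤ h γ) → ∀ J : ℤ,
        0 ≤ ∑ γ, h γ * (realEnv (insert s(a, b) M) C a b y z γ).andCon J)
      ∧ (∀ h0 h1 : ↥(insert s(a, b) M).powerset → ℝ, Monotone h0 → Monotone h1 → (∀ γ, 0 ≤ h0 γ) → (∀ γ, h0 γ ≤ h1 γ) → ∀ J : ℤ,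
          0 ≤ ∑ γ, (h1 γ * (realEnv (insert s(a, b) M) C a b y z γ).andE1 J + h0 γ * (realEnv (insert s(a, b) M) C a b y z γ).andE2 J)) := by
  have hfM : s(a, b) ∉ M := fun h => hg (Finset.mem_insert_of_mem (Finset.mem_insert_of_mem (Finset.mem_union_left _ h)))
  obtain ⟨f1, f2, f3, f4, f5⟩ := h5
  let φ : Bool × ↥M.powerset ≃ ↥(insert s(a, b) M).powerset :=
    { toFun := fun p => ⟨if p.1 then insert s(a, b) p.2.1 else p.2.1, Finset.mem_powerset.2 (by
        split_ifs
        · exact Finset.insert_subset_insert _ (Finset.mem_powerset.1 p.2.2)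
        · exact (Finset.mem_powerset.1 p.2.2).trans (Finset.subset_insert _ _))⟩
      invFun := fun δ => (decide (s(a, b) ∈ δ.1), ⟨δ.1.erase s(a, b), Finset.mem_powerset.2 fun e he =>
        (Finset.mem_insert.1 (Finset.mem_powerset.1 δ.2 (Finset.mem_of_mem_erase he))).resolve_left (Finset.ne_of_mem_erase he)⟩)
      left_inv := fun p => by
        obtain ⟨t, β⟩ := p
        have hfβ : s(a, b) ∉ β.1 := fun h => hfM (Finset.mem_powerset.1 β.2 h)
        cases t
        · exact Prod.ext (by simp [hfβ]) (Subtype.ext (by simp [Finset.erase_eq_of_notMem hfβ]))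
        · exact Prod.ext (by simp) (Subtype.ext (by simp [Finset.erase_insert hfβ]))
      right_inv := fun δ => by
        by_cases h : s(a, b) ∈ δ.1
        · exact Subtype.ext (by simp [h, Finset.insert_erase h])
        · exact Subtype.ext (by simp [h]) }
  have hφ : Monotone φ := by
    rintro ⟨t, β⟩ ⟨t', β'⟩ hle
    obtain ⟨hb, hβ⟩ := Prod.mk_le_mk.1 hle
    show (if t then insert s(a, b) β.1 else β.1) ⊆ (if t' then insert s(a, b) β'.1 else β'.1)
    cases t <;> cases t' <;> simp only [Bool.false_eq_true, ↓reduceIte]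
    · exact hβ
    · exact fun e he => Finset.mem_insert_of_mem (hβ he)
    · exact absurd hb (by decide)
    · exact Finset.insert_subset_insert _ hβ
  refine transfer_facts (E := parE (realEnv M C a b y z)) (κ := -1) hφ ?_
    ⟨f2, fun _ _ m0 m1 n0 le J => Mt_par_par_nonneg f2 f4 m0 m1 n0 le J,
      fun _ mh nh J => andDel_par_nonneg f5 mh nh J, fun _ mh nh J => andCon_par_nonneg f4 mh nh J,
      fun _ _ m0 m1 n0 le J => andFree_par_nonneg f5 f4 m0 m1 n0 le J⟩
  rintro ⟨bb, β⟩
  have hX : β.1 ⊆ M := Finset.mem_powerset.1 β.2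
  have p0 : β.1 ⊆ insert y (insert z M) := hX.trans ((Finset.subset_insert _ _).trans (Finset.subset_insert _ _))
  have py : insert y β.1 ⊆ insert y (insert z M) := Finset.insert_subset_insert _ (hX.trans (Finset.subset_insert _ _))
  have pz : insert z β.1 ⊆ insert y (insert z M) := (Finset.insert_subset_insert _ hX).trans (Finset.subset_insert _ _)
  have pyz : insert y (insert z β.1) ⊆ insert y (insert z M) := Finset.insert_subset_insert _ (Finset.insert_subset_insert _ hX)
  cases bb
  · show realEnv (insert s(a, b) M) C a b y z ⟨β.1, _⟩ = _
    simp only [realEnv, parE, EDat.par, PDat.par, realPDat_par_false hg hab p0, realPDat_par_false hg hab py,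
      realPDat_par_false hg hab pz, realPDat_par_false hg hab pyz, Bool.false_and, Bool.not_false, Bool.true_and, Bool.false_or,
      Bool.true_or, bit_false, add_zero]
  · show realEnv (insert s(a, b) M) C a b y z ⟨insert s(a, b) β.1, _⟩ = _
    simp only [realEnv, parE, EDat.par, PDat.par, Finset.insert_comm y s(a, b), Finset.insert_comm z s(a, b),
      realPDat_par_true hg hab, Bool.true_and, Bool.not_true, Bool.false_and, Bool.true_or, Bool.false_or, bit_false, add_zero]


end Letters

end RootForm

end FK

end Summit.CriticalPhenomena.PercolationContinuityZ3.Theorems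

end
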